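import Literature.MathematicalPhysics.QuantumFieldTheory.BalabanImbrieJaffe1984to88.BIJ88GaussShellSum309
import Literature.MathematicalPhysics.QuantumFieldTheory.BalabanImbrieJaffe1984to88.BIJ88ChiSlotDsetBound309
import Literature.MathematicalPhysics.QuantumFieldTheory.BalabanImbrieJaffe1984to88.BIJ88TrainTermBound307

/-!
# `BalabanImbrieJaffe1984to88.BIJ88TermHitShellBound309` — T. Bałaban, J. Imbrie, A. Jaffe, *Effective action and cluster properties of the
abelian Higgs model*, Commun. Math. Phys. **114** (1988) 257–315 [BalabanImbrieJaffe1988]: p. 307 [PDF 51] L5–18 (Sect. 5.13: *"Functional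
derivatives hitting χ-factors farther than ½r(e_k) from Λ₁₀^{(k)c} produce factors e^{−cp(e_k)²} after integrating with respect to A^{(k)″},
φ^{(k)″}. These derivatives are supported at |A^{(k)″}| ≥ cp(e_k) or |φ^{(k)″}| ≥ cp(e_k) … Functional derivatives hitting e^{−V^{(k)}(Y)} yield
factors e^β(L^kε/ε₀)^{1/4−α}. … Altogether we have small factors at each end of C_ω(α) … (Factorials can be produced when many functional
derivatives hit the same object, for example a characteristic function.)"*) and p. 309 [PDF 53] L21–28 ((5.14.4): *"Each t-derivative of a
χ-factor in χ′_{Λ₁₂^{(k)},t} gives at least a factor e^β(L^kε/ε₀)^{1/4−α} … After integration over A^{(k)}, we obtain factors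
ct^{−n}e^{−cp(te_k)²}"*) — **ONE TRAIN EXPECTATION OF THE LOCATED DERIVATIVE OBSERVABLES WITH A GAUSSIAN SHELL FACTOR FOR EVERY HIT χ-SLOT**
(differentiated in `t` OR by a functional derivative), the sharp form of the estimate E4c of the §f assembly.

The companion `BIJ88TermShellBound309`/`BIJ88CubeSlotCosts309` keep only the shells of the `t`-differentiated χ-slots (a common event for all
terms of the Leibniz sums); print's *"small factors at each end of C_ω(α)"* need the shell of EVERY χ-factor a leg lands on.  THIS FILE gets them
by expanding BEFORE integrating:
* §1 `obs_fD_eq_prod_slots` — the located cube product `Π_{□_i⊂X} fD_H(□_i)` is ONE product over the slots located in `X`;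
  `cbInf_uD_ext`; **`dset_obs_fD_uD_eq_sum`** — so a coordinate derivative `∂_{q_D}` of it is the sum over assignments `g : D → slots(X)` of
  `Π_τ ∂_{q_{D∩g⁻¹τ}}[u_{τ,m_τ}∘ext]` (p13's all-orders Leibniz rule `BIJ88ProductRuleAllOrders306.dset_prod_apply`);
* §2 **`abs_prod_dset_uD_le_indicator_hit`** — with the factored all-orders slot letters (χ-slot hit: `A_b(m,n)·Π_j w_b(q_j)·𝟙_shell`; χ-slot free:
  `≤ 1 ≤ A_b(0,0)`, `BIJ88ChiSlotDsetBound309.abs_dset_uD_inl_zero_empty_le_one`; `V`-slot: `A_Y(m,n)·Π_j w_Y(q_j)`) each assignment term is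
  `≤ (Π_τ A_τ(m_τ,n_τ)·Π_j w_τ(q_j)) · 1{a_b ≤ |Φ_b(ext φ)| for every χ-slot b of X hit by t or by a leg}`;
* §3 **`abs_trains_obs_le_sum_indicator`** — the trains (end-data sum, `BIJ88TrainsDsetExpansion306.trains_apply_eq_sum_dset`) applied to the
  product: `|(Π_k𝕋_{c_k})Π fD_H(□_i)(φ)| ≤ Σ_{(E,g)} |trainCoef_E|·(Π_τ A_τ Π w_τ)·1_{hit shells of (E,g)}(φ)`;
* §4 **`abs_gexp_trains_obs_le_hit`** — Gaussian integration term by term (`BIJ88GaussShellSum309.abs_gexp_prec_le_sum_shell`):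
  `|⟨(Π_k𝕋_{c_k}) Π fD_H(□_i)⟩_{s,X}| ≤ Σ_{(E,g)} |trainCoef_E| · (Π_τ A_τ(m_τ,n_τ(E,g)) Π_j w_τ(q_j)) · Π_{b hit by (H,E,g)} 2e^{−a_b(a_b−2ΛF/m)/(2Λ²/m)}`
  for every `s ∈ [0,1]^I`.

statement-level skeleton of published theorems with citation tags; proofs where landed; nothing here is a claim about the Yang–Mills mass gap

PDF held: `paper:balaban1988-cmp114-bij-abelian-higgs-effective-action` (journal page = PDF page + 256); pages re-read this session as text:
PDF 51 (p. 307) L2–20, PDF 53 (p. 309) L12–28.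

CITATION HEADER (lean-in-tree rule).  Part of the lit-balaban TYPED SKELETON (HOME `run/shared/lean/pub/lit-balaban/`), Phase 2, seat p36
(gen 22, unit `lit-balaban-p36`); rows **C2.Eq5.14.3-5.14.4** (member: §f estimate E4c, sharp form — every hit χ-slot pays its shell) and
C2.Eq5.13.3-5.13.4 (member) of `HOME/lit-balaban-r16/ROWS-C2-part2.md` (owner r16, referee ref-5).  Theorem-only; no definitions, no `Prop`
facts; axioms standard.
HONEST SCOPE.  The slot letters `A_τ, w_τ` (χ-slots dischargeable by `BIJ88ChiSlotDsetBound309.exists_abs_dset_uD_inl_le` with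
`w_b(q) = |Φ_b(ext e_q)|`; `V`-slots = r16's typing gap #1 in all-orders form), the frame letter `Λ` of the χ-slots of `X`, the coercivity `m`, the
source bound `F` and the thresholds `a_b ≤ a′_b` are inputs; the train coefficients are not estimated here; linear χ-slot fields only.
NOT summit progress; NOT continuum; NOT Clay.

REVISION (doc-only, referee/owner items N-ref1-g107-2 / N-ref1-g115-1 / D-owner-v2.389): the p. 307 L5–13 quotation above now carries print's region symbols
`Λ₁₀^{(k)c}` / `Λ₁₁^{(k)}` and *"χ′-factors"* where applicable; no declaration changed.
-/

namespace Literature.MathematicalPhysics.QuantumFieldTheory.BalabanImbrieJaffe1984to88.BIJ88TermHitShellBound309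

open Finset Matrix
open scoped BigOperators
open BIJ88Sect5Statements (CutoffProfile)
open BIJ88WickSourceSmooth305 (dset)
open BIJ88SmoothFactors5133 (CbInf extCLM extCLM_apply)
open BIJ88ProductRuleAllOrders306 (dset_prod_apply mem_asg)
open BIJ88TrainPieces306 (wker)
open BIJ88WalkForm5133 (trains)
open BIJ88TrainsDsetExpansion306 (trainCoef trainLegs trainSite trains_apply_eq_sum_dset)
open BIJ88TrainTermBound307 (abs_prod_le_prod_mul_indicator mul_indicator_le_mul_indicator_of_subset)
open BIJ88PolymerRep5134Gauss (obs prec src ext)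
open BIJ88TruncationConnected306 (gexp)
open BIJ88Expansion5143Gauss (fD)
open BIJ88SlotMomentsGauss308 (uD)
open BIJ88ChiSlotDsetBound309 (abs_dset_uD_inl_zero_empty_le_one)
open BIJ88GaussShellSum309 (abs_gexp_prec_le_sum_shell)

variable {α I : Type} [Fintype α] [DecidableEq α] [Fintype I] [DecidableEq I] (blk : α → I) (Δ : Matrix α α ℝ) (ℱ : α → ℝ)
  (X : Finset I)
variable (χ : CutoffProfile) {ι υ : Type} [DecidableEq ι] [DecidableEq υ] (p : ℝ) {ek t : ℝ} (B : Finset ι)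
  {Φ : ι → (α → ℝ) → ℝ} {c : ι → ℝ} (Ys : Finset υ) {V : υ → (α → ℝ) → ℝ} (cube : ↥B ⊕ ↥Ys → I) {L : Type*} (γ : L → ↥B ⊕ ↥Ys)

/-! ## §1  The located cube product is one product over the slots of `X`; its coordinate derivatives -/

omit [Fintype α] [DecidableEq α] [Fintype I] in
/-- **`Π_{□_i⊂X} fD_H(□_i) = Π_{τ: cube τ ∈ X} u_{τ,m_τ}`** read on the fields of `X` (`m_τ = #{j ∈ H : γ_j = τ}`): regrouping the slot factors
of the cubes of `X` (p. 304: *"f(□_i) is the product of all the factors … localized in □_i"*). [cite: BalabanImbrieJaffe1988, (5.14.3) p.308–309] -/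
theorem obs_fD_eq_prod_slots (u : ↥B ⊕ ↥Ys → ℕ → (α → ℝ) → ℝ) (K : Finset L) (ψ : BIJ88PolymerRep5134Gauss.Site blk X → ℝ) :
    obs blk (fD u cube γ K) X ψ = ∏ τ ∈ univ.filter (fun τ => cube τ ∈ X), u τ (K.filter fun j => γ j = τ).card (ext blk X ψ) := by
  rw [obs, ← prod_fiberwise_of_maps_to (s := univ.filter fun τ : ↥B ⊕ ↥Ys => cube τ ∈ X) (t := X) (g := cube)
    (fun τ hτ => (mem_filter.1 hτ).2)]
  refine prod_congr rfl fun i hi => ?_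
  rw [fD]
  refine prod_congr ?_ fun τ _ => rfl
  ext τ
  simp only [mem_filter, mem_univ, true_and]
  exact ⟨fun h => ⟨h ▸ hi, h⟩, fun h => h.2⟩

omit [DecidableEq α] [Fintype I] [DecidableEq ι] [DecidableEq υ] in
/-- the located slot derivative factors read on the fields of `X` are `C_b^∞` (linear χ-slot fields, `c_b ≠ 0`, `V_Y ∈ C_b^∞`, `t` on the branch;
`BIJ88SlotFactorsSmooth308.cbInf_uD_inl`/`_inr` composed with the extension map). [cite: BalabanImbrieJaffe1988, (5.14.2)–(5.14.3) p.308–309] -/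
theorem cbInf_uD_ext (hek : 0 < ek) (ht : 0 < t) (h1 : t * ek < 1) (hΦ : ∀ b ∈ B, IsLinearMap ℝ (Φ b)) (hc : ∀ b ∈ B, c b ≠ 0)
    (hV : ∀ Y ∈ Ys, CbInf (V Y)) (τ : ↥B ⊕ ↥Ys) (m : ℕ) :
    CbInf fun ψ : BIJ88PolymerRep5134Gauss.Site blk X → ℝ => uD χ p ek B Φ c Ys V t τ m (ext blk X ψ) := by
  have h : CbInf (uD χ p ek B Φ c Ys V t τ m) := by
    rcases τ with b | Y
    · exact BIJ88SlotFactorsSmooth308.cbInf_uD_inl χ p B Ys hek ht h1 b (hΦ b.1 b.2) (hc b.1 b.2) m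
    · exact BIJ88SlotFactorsSmooth308.cbInf_uD_inr χ p B Ys Y (hV Y.1 Y.2) m
  refine (congrArg CbInf (funext fun ψ => ?_)).mp (h.comp_clm (extCLM blk X))
  rw [extCLM_apply]

omit [Fintype I] in
/-- **`∂_{q_D}[Π_{□_i⊂X} fD_H(□_i)](φ) = Σ_{g : D → slots(X)} Π_{τ: cube τ ∈ X} ∂_{q_{D∩g⁻¹τ}}[u_{τ,m_τ}∘ext](φ)`** — the all-orders Leibniz rule
(`BIJ88ProductRuleAllOrders306.dset_prod_apply`) on the slot product of §1: every leg `j ∈ D` is assigned a slot `g j` located in `X` (the legs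
off `D` are parked at `τ₀`). [cite: BalabanImbrieJaffe1988, §5.13 Eq. (5.13.3) p.306, (5.14.3) p.309] -/
theorem dset_obs_fD_uD_eq_sum {κ : Type} [LinearOrder κ] [Fintype κ] (hek : 0 < ek) (ht : 0 < t) (h1 : t * ek < 1)
    (hΦ : ∀ b ∈ B, IsLinearMap ℝ (Φ b)) (hc : ∀ b ∈ B, c b ≠ 0) (hV : ∀ Y ∈ Ys, CbInf (V Y)) (K : Finset L) (τ₀ : ↥B ⊕ ↥Ys)
    (q : κ → BIJ88PolymerRep5134Gauss.Site blk X) (D : Finset κ) (φ : BIJ88PolymerRep5134Gauss.Site blk X → ℝ) :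
    dset (fun j => Pi.single (q j) (1 : ℝ)) D (obs blk (fD (uD χ p ek B Φ c Ys V t) cube γ K) X) φ =
      ∑ g ∈ Fintype.piFinset (fun j => if j ∈ D then univ.filter (fun τ => cube τ ∈ X) else {τ₀}),
        ∏ τ ∈ univ.filter (fun τ => cube τ ∈ X),
          dset (fun j => Pi.single (q j) (1 : ℝ)) (D.filter fun j => g j = τ)
            (fun ψ => uD χ p ek B Φ c Ys V t τ (K.filter fun j => γ j = τ).card (ext blk X ψ)) φ := by
  have hobs : obs blk (fD (uD χ p ek B Φ c Ys V t) cube γ K) X = fun ψ => ∏ τ ∈ univ.filter (fun τ => cube τ ∈ X),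
      uD χ p ek B Φ c Ys V t τ (K.filter fun j => γ j = τ).card (ext blk X ψ) :=
    funext fun ψ => obs_fD_eq_prod_slots blk X B Ys cube γ _ K ψ
  rw [hobs]
  exact dset_prod_apply (fun j => Pi.single (q j) (1 : ℝ)) (univ.filter fun τ => cube τ ∈ X) τ₀ D
    (fun τ ψ => uD χ p ek B Φ c Ys V t τ (K.filter fun j => γ j = τ).card (ext blk X ψ))
    (fun τ _ => cbInf_uD_ext blk X χ p B Ys hek ht h1 hΦ hc hV τ _) φ

/-! ## §2  One assignment term: slot letters, and the shell of EVERY hit χ-slot kept -/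

omit [Fintype α] [Fintype I] in
/-- **ONE ASSIGNMENT TERM, ALL HIT SHELLS KEPT**: with the factored all-orders slot letters — a χ-slot `b` receiving `t`-derivatives or legs
(`(m,n) ≠ (0,0)`): `|∂_{q_{D′}}[u_{b,m}∘ext](φ)| ≤ A_b(m,|D′|)·(Π_{j∈D′} w_b(q_j))·𝟙_{[a_b,a′_b]}(|Φ_b(ext φ)|)`; a free χ-slot costs `≤ 1 ≤ A_b(0,0)`;
a `V`-slot `Y`: `≤ A_Y(m,|D′|)·Π_{j∈D′} w_Y(q_j)` (`A, w ≥ 0`) — the term of the assignment `g` obeys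
`|Π_{τ: cube τ∈X} ∂_{q_{D∩g⁻¹τ}}[u_{τ,m_τ}∘ext](φ)| ≤ (Π_τ A_τ(m_τ,n_τ)·Π_{j∈D∩g⁻¹τ} w_τ(q_j)) · 1{a_b ≤ |Φ_b(ext φ)| for every χ-slot b of X with
m_b ≠ 0 or n_b ≠ 0}(φ)`, `n_τ = |D∩g⁻¹τ|` (p. 307: every functional derivative hitting a χ-factor is *"supported at |A^{(k)″}| ≥ cp(e_k)"*;
p. 309: so is every `t`-derivative of a χ-factor). [cite: BalabanImbrieJaffe1988, §5.13 p.307, (5.14.4) p.309] -/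
theorem abs_prod_dset_uD_le_indicator_hit {κ : Type} [LinearOrder κ] [Fintype κ] (K : Finset L)
    (q : κ → BIJ88PolymerRep5134Gauss.Site blk X) (D : Finset κ) (g : κ → ↥B ⊕ ↥Ys)
    {A : ↥B ⊕ ↥Ys → ℕ → ℕ → ℝ} (hA : ∀ τ m n, 0 ≤ A τ m n) (hA1 : ∀ b : ↥B, 1 ≤ A (Sum.inl b) 0 0)
    {w : ↥B ⊕ ↥Ys → BIJ88PolymerRep5134Gauss.Site blk X → ℝ} (hw : ∀ τ x, 0 ≤ w τ x) {a a' : ↥B → ℝ}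
    (hχ : ∀ (b : ↥B) (m : ℕ) (D' : Finset κ) (φ : BIJ88PolymerRep5134Gauss.Site blk X → ℝ), (m ≠ 0 ∨ D'.card ≠ 0) →
      |dset (fun j => Pi.single (q j) (1 : ℝ)) D' (fun ψ => uD χ p ek B Φ c Ys V t (Sum.inl b) m (ext blk X ψ)) φ| ≤
        A (Sum.inl b) m D'.card * (∏ j ∈ D', w (Sum.inl b) (q j)) *
          Set.indicator (Set.Icc (a b) (a' b)) (fun _ => (1 : ℝ)) |Φ b (ext blk X φ)|)
    (hY : ∀ (Y : ↥Ys) (m : ℕ) (D' : Finset κ) (φ : BIJ88PolymerRep5134Gauss.Site blk X → ℝ),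
      |dset (fun j => Pi.single (q j) (1 : ℝ)) D' (fun ψ => uD χ p ek B Φ c Ys V t (Sum.inr Y) m (ext blk X ψ)) φ| ≤
        A (Sum.inr Y) m D'.card * ∏ j ∈ D', w (Sum.inr Y) (q j))
    (φ : BIJ88PolymerRep5134Gauss.Site blk X → ℝ) :
    |∏ τ ∈ univ.filter (fun τ => cube τ ∈ X),
        dset (fun j => Pi.single (q j) (1 : ℝ)) (D.filter fun j => g j = τ)
          (fun ψ => uD χ p ek B Φ c Ys V t τ (K.filter fun j => γ j = τ).card (ext blk X ψ)) φ| ≤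
      (∏ τ ∈ univ.filter (fun τ => cube τ ∈ X),
          (A τ (K.filter fun j => γ j = τ).card (D.filter fun j => g j = τ).card * ∏ j ∈ D.filter (fun j => g j = τ), w τ (q j))) *
        {φ : BIJ88PolymerRep5134Gauss.Site blk X → ℝ | ∀ b : ↥B, cube (Sum.inl b) ∈ X →
            ((K.filter fun j => γ j = Sum.inl b).card ≠ 0 ∨ (D.filter fun j => g j = Sum.inl b).card ≠ 0) →
            a b ≤ |Φ b (ext blk X φ)|}.indicator 1 φ := by
  classical
  -- hit slots: χ-slots with a `t`-derivative or a leg; their events: the (lower) shells; free slots and `V`-slots carry no event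
  let P : ↥B ⊕ ↥Ys → Prop := fun τ => (∃ b : ↥B, τ = Sum.inl b) ∧
    ((K.filter fun j => γ j = τ).card ≠ 0 ∨ (D.filter fun j => g j = τ).card ≠ 0)
  let Sh : ↥B ⊕ ↥Ys → Set (BIJ88PolymerRep5134Gauss.Site blk X → ℝ) :=
    fun τ => Sum.elim (fun b => {φ | a b ≤ |Φ b (ext blk X φ)|}) (fun _ => Set.univ) τ
  have hone : ∀ (S : Set ℝ) (x : ℝ), Set.indicator S (fun _ => (1 : ℝ)) x ≤ 1 := fun S x => by
    by_cases hx : x ∈ S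
    · rw [Set.indicator_of_mem hx]
    · rw [Set.indicator_of_notMem hx]; exact zero_le_one
  have h := abs_prod_le_prod_mul_indicator (univ.filter fun τ : ↥B ⊕ ↥Ys => cube τ ∈ X) P
    (a := fun τ φ => dset (fun j => Pi.single (q j) (1 : ℝ)) (D.filter fun j => g j = τ)
      (fun ψ => uD χ p ek B Φ c Ys V t τ (K.filter fun j => γ j = τ).card (ext blk X ψ)) φ)
    (c := fun τ => A τ (K.filter fun j => γ j = τ).card (D.filter fun j => g j = τ).card * ∏ j ∈ D.filter (fun j => g j = τ), w τ (q j))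
    Sh (fun τ _ => mul_nonneg (hA _ _ _) (prod_nonneg fun j _ => hw _ _)) (fun τ _ hP φ => ?_) (fun τ _ hP φ => ?_) φ
  · refine h.trans (mul_indicator_le_mul_indicator_of_subset (fun ψ hψ => ?_)
      (prod_nonneg fun τ _ => mul_nonneg (hA _ _ _) (prod_nonneg fun j _ => hw _ _)) φ)
    -- the joint event of the hit slots is the displayed event
    intro b hbX hb
    have hmem : (Sum.inl b : ↥B ⊕ ↥Ys) ∈ (univ.filter fun τ : ↥B ⊕ ↥Ys => cube τ ∈ X).filter P :=
      mem_filter.2 ⟨mem_filter.2 ⟨mem_univ _, hbX⟩, ⟨b, rfl⟩, hb⟩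
    exact Set.mem_iInter₂.1 hψ (Sum.inl b) hmem
  · -- a hit slot: it is a χ-slot with `(m, n) ≠ (0, 0)`; its two-sided shell indicator is at most the lower one
    obtain ⟨⟨b, rfl⟩, hb⟩ := hP
    refine (hχ b _ _ φ hb).trans ?_
    simp only [Sh, Sum.elim_inl]
    refine mul_le_mul_of_nonneg_left ?_ (mul_nonneg (hA _ _ _) (prod_nonneg fun j _ => hw _ _))
    by_cases hm : a b ≤ |Φ b (ext blk X φ)|
    · rw [Set.indicator_of_mem (show φ ∈ {φ | a b ≤ |Φ b (ext blk X φ)|} from hm), Pi.one_apply]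
      exact hone _ _
    · rw [Set.indicator_of_notMem (show |Φ b (ext blk X φ)| ∉ Set.Icc (a b) (a' b) from fun h' => hm h'.1),
        Set.indicator_of_notMem (show φ ∉ {φ | a b ≤ |Φ b (ext blk X φ)|} from hm)]
  · -- a slot that is not hit: a free χ-slot (`≤ 1 ≤ A_b(0,0)`, empty leg set) or a `V`-slot (its letter)
    rcases τ with b | Y
    · have hb : (K.filter fun j => γ j = Sum.inl b).card = 0 ∧ (D.filter fun j => g j = Sum.inl b).card = 0 := by
        by_contra hne
        exact hP ⟨⟨b, rfl⟩, by omega⟩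
      have hD0 : D.filter (fun j => g j = Sum.inl b) = ∅ := card_eq_zero.1 hb.2
      simp only [hb.1, hD0, card_empty, prod_empty, mul_one]
      exact (abs_dset_uD_inl_zero_empty_le_one χ blk p B Ys X b q ek t φ).trans (hA1 b)
    · exact hY Y _ _ φ

/-! ## §3  The trains applied to the product: a sum over end data and assignments, hit shells kept -/

omit [Fintype I] in
/-- **`|(Π_k 𝕋_{c_k}) Π_{□_i⊂X} fD_H(□_i) (φ)| ≤ Σ_E Σ_{g} |trainCoef_E| · (Π_τ A_τ(m_τ,n_τ(E,g))·Π_j w_τ(q_j)) · 1{hit shells of (H,E,g)}(φ)`** — the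
end-data sum of `BIJ88TrainsDsetExpansion306.trains_apply_eq_sum_dset`, the assignment sum of §1 and the term bound of §2 (the event now
depends on the term: it is summed, not factored). [cite: BalabanImbrieJaffe1988, §5.13 Eq. (5.13.3) p.306, p.307, (5.14.4) p.309] -/
theorem abs_trains_obs_le_sum_indicator (hek : 0 < ek) (ht : 0 < t) (h1 : t * ek < 1) (hΦ : ∀ b ∈ B, IsLinearMap ℝ (Φ b))
    (hc : ∀ b ∈ B, c b ≠ 0) (hV : ∀ Y ∈ Ys, CbInf (V Y)) (K : Finset L) (τ₀ : ↥B ⊕ ↥Ys)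
    (fsrc : BIJ88PolymerRep5134Gauss.Site blk X → ℝ)
    (C : Matrix (BIJ88PolymerRep5134Gauss.Site blk X) (BIJ88PolymerRep5134Gauss.Site blk X) ℝ)
    (N : Finset I → Matrix (BIJ88PolymerRep5134Gauss.Site blk X) (BIJ88PolymerRep5134Gauss.Site blk X) ℝ)
    (Lt : List (Finset (Finset I)))
    {A : ↥B ⊕ ↥Ys → ℕ → ℕ → ℝ} (hA : ∀ τ m n, 0 ≤ A τ m n) (hA1 : ∀ b : ↥B, 1 ≤ A (Sum.inl b) 0 0)
    {w : ↥B ⊕ ↥Ys → BIJ88PolymerRep5134Gauss.Site blk X → ℝ} (hw : ∀ τ x, 0 ≤ w τ x) {a a' : ↥B → ℝ}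
    (hχ : ∀ (q : Fin Lt.length ×ₗ Fin 2 → BIJ88PolymerRep5134Gauss.Site blk X) (b : ↥B) (m : ℕ) (D' : Finset (Fin Lt.length ×ₗ Fin 2))
      (φ : BIJ88PolymerRep5134Gauss.Site blk X → ℝ), (m ≠ 0 ∨ D'.card ≠ 0) →
      |dset (fun j => Pi.single (q j) (1 : ℝ)) D' (fun ψ => uD χ p ek B Φ c Ys V t (Sum.inl b) m (ext blk X ψ)) φ| ≤
        A (Sum.inl b) m D'.card * (∏ j ∈ D', w (Sum.inl b) (q j)) *
          Set.indicator (Set.Icc (a b) (a' b)) (fun _ => (1 : ℝ)) |Φ b (ext blk X φ)|)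
    (hY : ∀ (q : Fin Lt.length ×ₗ Fin 2 → BIJ88PolymerRep5134Gauss.Site blk X) (Y : ↥Ys) (m : ℕ) (D' : Finset (Fin Lt.length ×ₗ Fin 2))
      (φ : BIJ88PolymerRep5134Gauss.Site blk X → ℝ),
      |dset (fun j => Pi.single (q j) (1 : ℝ)) D' (fun ψ => uD χ p ek B Φ c Ys V t (Sum.inr Y) m (ext blk X ψ)) φ| ≤
        A (Sum.inr Y) m D'.card * ∏ j ∈ D', w (Sum.inr Y) (q j))
    (φ : BIJ88PolymerRep5134Gauss.Site blk X → ℝ) :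
    |trains fsrc C N Lt (obs blk (fD (uD χ p ek B Φ c Ys V t) cube γ K) X) φ| ≤
      ∑ E : Fin Lt.length → BIJ88PolymerRep5134Gauss.Site blk X ⊕
          (BIJ88PolymerRep5134Gauss.Site blk X × BIJ88PolymerRep5134Gauss.Site blk X),
        ∑ g ∈ Fintype.piFinset (fun j => if j ∈ trainLegs E then univ.filter (fun τ => cube τ ∈ X) else {τ₀}),
          |trainCoef fsrc (fun k => C * wker C N (Lt.get k)) E| *
            (∏ τ ∈ univ.filter (fun τ => cube τ ∈ X),
              (A τ (K.filter fun j => γ j = τ).card ((trainLegs E).filter fun j => g j = τ).card *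
                ∏ j ∈ (trainLegs E).filter (fun j => g j = τ), w τ (trainSite E j))) *
            {φ : BIJ88PolymerRep5134Gauss.Site blk X → ℝ | ∀ b : ↥B, cube (Sum.inl b) ∈ X →
                ((K.filter fun j => γ j = Sum.inl b).card ≠ 0 ∨ ((trainLegs E).filter fun j => g j = Sum.inl b).card ≠ 0) →
                a b ≤ |Φ b (ext blk X φ)|}.indicator 1 φ := by
  have hobs : CbInf (obs blk (fD (uD χ p ek B Φ c Ys V t) cube γ K) X) :=
    CbInf.obs blk _ X fun i _ => BIJ88SlotFactorsSmooth308.cbInf_fD_uD χ p B Ys hek ht h1 hΦ hc hV cube γ K i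
  rw [trains_apply_eq_sum_dset fsrc C N hobs Lt φ]
  refine (abs_sum_le_sum_abs _ _).trans (sum_le_sum fun E _ => ?_)
  rw [abs_mul, dset_obs_fD_uD_eq_sum blk X χ p B Ys cube γ hek ht h1 hΦ hc hV K τ₀ (trainSite E) (trainLegs E) φ]
  refine (mul_le_mul_of_nonneg_left (abs_sum_le_sum_abs _ _) (abs_nonneg _)).trans ?_
  rw [mul_sum]
  refine sum_le_sum fun g _ => ?_
  rw [mul_assoc]
  exact mul_le_mul_of_nonneg_left
    (abs_prod_dset_uD_le_indicator_hit blk X χ p B Ys cube γ K (trainSite E) (trainLegs E) g hA hA1 hw (hχ (trainSite E))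
      (hY (trainSite E)) φ) (abs_nonneg _)

/-! ## §4  Gaussian integration term by term: every hit χ-slot pays its shell factor -/

/-- **ONE TRAIN EXPECTATION, SHARP FORM**: for `Δ ≻ 0` with `Δ ≥ m > 0`, `s ∈ [0,1]^I`, the χ-slots located in `X` linear with the frame letter
`|Σ_bθ_bΦ_b(φ)| ≤ Λ‖θ‖₂‖φ‖₂`, `‖ℱ|_X‖₂ ≤ F`, thresholds `0 ≤ a_b`, and the slot letters of §2:
`|⟨(Π_k 𝕋_{c_k}) Π_{□_i⊂X} fD_H(□_i)⟩_{s,X}| ≤ Σ_E Σ_g |trainCoef_E| · (Π_τ A_τ(m_τ,n_τ(E,g))·Π_j w_τ(q_j)) · Π_{b: χ-slot of X with m_b ≠ 0 or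
n_b(E,g) ≠ 0} 2e^{−a_b(a_b−2ΛF/m)/(2Λ²/m)}` — print's *"Functional derivatives hitting χ-factors … produce factors e^{−cp(e_k)²}"* AND *"Each
t-derivative of a χ-factor … gives at least a factor …"*, both at once, for ANY train kernels `C, N_b`.
[cite: BalabanImbrieJaffe1988, §5.13 p.307, (5.14.4) p.309] -/
theorem abs_gexp_trains_obs_le_hit (hΔ : Δ.PosDef) {m : ℝ} (hm : 0 < m) (hΔm : ∀ φ : α → ℝ, m * (φ ⬝ᵥ φ) ≤ φ ⬝ᵥ (Δ *ᵥ φ))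
    {s : I → ℝ} (hs : ∀ i, 0 ≤ s i ∧ s i ≤ 1)
    (hek : 0 < ek) (ht : 0 < t) (h1 : t * ek < 1) (hΦ : ∀ b ∈ B, IsLinearMap ℝ (Φ b)) (hc : ∀ b ∈ B, c b ≠ 0)
    (hV : ∀ Y ∈ Ys, CbInf (V Y)) (K : Finset L) (τ₀ : ↥B ⊕ ↥Ys) {Λ : ℝ} (hΛ : 0 < Λ)
    (hframe : ∀ (θ : ↥(univ.filter fun b : ↥B => cube (Sum.inl b) ∈ X) → ℝ) (φ : α → ℝ),
      |∑ b, θ b * Φ b.1.1 φ| ≤ Λ * Real.sqrt (∑ b, θ b ^ 2) * Real.sqrt (φ ⬝ᵥ φ))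
    {F : ℝ} (hF0 : 0 ≤ F) (hF : src blk ℱ X ⬝ᵥ src blk ℱ X ≤ F ^ 2) {a a' : ↥B → ℝ} (ha : ∀ b, 0 ≤ a b)
    (C : Matrix (BIJ88PolymerRep5134Gauss.Site blk X) (BIJ88PolymerRep5134Gauss.Site blk X) ℝ)
    (N : Finset I → Matrix (BIJ88PolymerRep5134Gauss.Site blk X) (BIJ88PolymerRep5134Gauss.Site blk X) ℝ)
    (Lt : List (Finset (Finset I)))
    {A : ↥B ⊕ ↥Ys → ℕ → ℕ → ℝ} (hA : ∀ τ m n, 0 ≤ A τ m n) (hA1 : ∀ b : ↥B, 1 ≤ A (Sum.inl b) 0 0)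
    {w : ↥B ⊕ ↥Ys → BIJ88PolymerRep5134Gauss.Site blk X → ℝ} (hw : ∀ τ x, 0 ≤ w τ x)
    (hχ : ∀ (q : Fin Lt.length ×ₗ Fin 2 → BIJ88PolymerRep5134Gauss.Site blk X) (b : ↥B) (m : ℕ) (D' : Finset (Fin Lt.length ×ₗ Fin 2))
      (φ : BIJ88PolymerRep5134Gauss.Site blk X → ℝ), (m ≠ 0 ∨ D'.card ≠ 0) →
      |dset (fun j => Pi.single (q j) (1 : ℝ)) D' (fun ψ => uD χ p ek B Φ c Ys V t (Sum.inl b) m (ext blk X ψ)) φ| ≤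
        A (Sum.inl b) m D'.card * (∏ j ∈ D', w (Sum.inl b) (q j)) *
          Set.indicator (Set.Icc (a b) (a' b)) (fun _ => (1 : ℝ)) |Φ b (ext blk X φ)|)
    (hY : ∀ (q : Fin Lt.length ×ₗ Fin 2 → BIJ88PolymerRep5134Gauss.Site blk X) (Y : ↥Ys) (m : ℕ) (D' : Finset (Fin Lt.length ×ₗ Fin 2))
      (φ : BIJ88PolymerRep5134Gauss.Site blk X → ℝ),
      |dset (fun j => Pi.single (q j) (1 : ℝ)) D' (fun ψ => uD χ p ek B Φ c Ys V t (Sum.inr Y) m (ext blk X ψ)) φ| ≤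
        A (Sum.inr Y) m D'.card * ∏ j ∈ D', w (Sum.inr Y) (q j)) :
    |gexp (prec blk Δ X s) (src blk ℱ X) (trains (src blk ℱ X) C N Lt (obs blk (fD (uD χ p ek B Φ c Ys V t) cube γ K) X))| ≤
      ∑ E : Fin Lt.length → BIJ88PolymerRep5134Gauss.Site blk X ⊕
          (BIJ88PolymerRep5134Gauss.Site blk X × BIJ88PolymerRep5134Gauss.Site blk X),
        ∑ g ∈ Fintype.piFinset (fun j => if j ∈ trainLegs E then univ.filter (fun τ => cube τ ∈ X) else {τ₀}),
          |trainCoef (src blk ℱ X) (fun k => C * wker C N (Lt.get k)) E| *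
            (∏ τ ∈ univ.filter (fun τ => cube τ ∈ X),
              (A τ (K.filter fun j => γ j = τ).card ((trainLegs E).filter fun j => g j = τ).card *
                ∏ j ∈ (trainLegs E).filter (fun j => g j = τ), w τ (trainSite E j))) *
            ∏ b ∈ (univ.filter fun b : ↥B => cube (Sum.inl b) ∈ X).attach.filter (fun b =>
                (K.filter fun j => γ j = Sum.inl b.1).card ≠ 0 ∨ ((trainLegs E).filter fun j => g j = Sum.inl b.1).card ≠ 0),
              2 * Real.exp (-(a b.1 * (a b.1 - 2 * (Λ * F / m)) / (2 * (Λ ^ 2 / m)))) := by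
  classical
  -- index the terms by the pairs `(E, g)` and integrate with `BIJ88GaussShellSum309.abs_gexp_prec_le_sum_shell`
  have h := abs_gexp_prec_le_sum_shell blk Δ ℱ (univ.filter fun b : ↥B => cube (Sum.inl b) ∈ X) (Φ := fun b : ↥B => Φ b) hΔ hm hΔm hs X (fun b _ => hΦ b.1 b.2) hΛ hframe hF0 hF
    (a := fun b : ↥(univ.filter fun b : ↥B => cube (Sum.inl b) ∈ X) => a b.1) (fun b => ha b.1)
    ((univ : Finset (Fin Lt.length → BIJ88PolymerRep5134Gauss.Site blk X ⊕
        (BIJ88PolymerRep5134Gauss.Site blk X × BIJ88PolymerRep5134Gauss.Site blk X))).sigma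
      fun E => Fintype.piFinset (fun j => if j ∈ trainLegs E then univ.filter (fun τ => cube τ ∈ X) else {τ₀}))
    (fun Eg => (univ.filter fun b : ↥B => cube (Sum.inl b) ∈ X).attach.filter fun b =>
      (K.filter fun j => γ j = Sum.inl b.1).card ≠ 0 ∨ ((trainLegs Eg.1).filter fun j => Eg.2 j = Sum.inl b.1).card ≠ 0)
    (M := fun Eg => |trainCoef (src blk ℱ X) (fun k => C * wker C N (Lt.get k)) Eg.1| *
      ∏ τ ∈ univ.filter (fun τ => cube τ ∈ X),
        (A τ (K.filter fun j => γ j = τ).card ((trainLegs Eg.1).filter fun j => Eg.2 j = τ).card *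
          ∏ j ∈ (trainLegs Eg.1).filter (fun j => Eg.2 j = τ), w τ (trainSite Eg.1 j)))
    (fun Eg _ => mul_nonneg (abs_nonneg _) (prod_nonneg fun τ _ => mul_nonneg (hA _ _ _) (prod_nonneg fun j _ => hw _ _)))
    (G := trains (src blk ℱ X) C N Lt (obs blk (fD (uD χ p ek B Φ c Ys V t) cube γ K) X)) fun ω => ?_
  · rw [sum_sigma] at h
    exact h
  · -- the pointwise bound of §3, rewritten as a sum over the pairs and with the event in the sub-family form
    rw [sum_sigma]
    refine (abs_trains_obs_le_sum_indicator blk X χ p B Ys cube γ hek ht h1 hΦ hc hV K τ₀ (src blk ℱ X) C N Lt hA hA1 hw hχ hY ω).trans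
      (sum_le_sum fun E _ => sum_le_sum fun g _ => mul_indicator_le_mul_indicator_of_subset (fun ψ hψ => ?_)
        (mul_nonneg (abs_nonneg _) (prod_nonneg fun τ _ => mul_nonneg (hA _ _ _) (prod_nonneg fun j _ => hw _ _))) ω)
    intro b hb
    obtain ⟨-, hb'⟩ := mem_filter.1 hb
    exact hψ b.1 (mem_filter.1 b.2).2 hb'

end Literature.MathematicalPhysics.QuantumFieldTheory.BalabanImbrieJaffe1984to88.BIJ88TermHitShellBound309
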